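import Summits.Ventures.Crystal3D.Theses.StickyWulffConstant

/-!
# Route StickyWulffConstant — the `Assembly` item (stmt-Ventures-19148)

The assembly item of route `route-Ventures-StickyWulffConstant` is, by construction (D-0027 §2.1),
the type of the route's gate-written deciding theorem `closes`:
`NoReconstructionGain → StackingLiminf → LiminfAssembly → WulffUpperBound →
Summit.Ventures.Crystal3D.SurfaceConstantExists`. This file records it as a theorem — the curried
form of `closes`. Pure bookkeeping: no crux of the route is touched; rung F-C1 is not moved.
-/

namespace Summit.Ventures.Crystal3D.Theorems

open Summit.Ventures.Crystal3D.Theses.StickyWulffConstant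

/-- The route's `Assembly` item (stmt-Ventures-19148) holds: it is the free closure of the route's
deciding theorem `closes` (the four cruxes imply `SurfaceConstantExists` with `κ = 6·2^{1/3}`). -/
theorem assembly_proof : Summit.Ventures.Crystal3D.Theses.StickyWulffConstant.Assembly :=
  fun h₁ h₂ h₃ h₄ => closes h₁ h₂ h₃ h₄

end Summit.Ventures.Crystal3D.Theorems
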